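import Summits.KontsevichZagierPeriods.KontsevichZagierPeriods.Theorems.ReducedPeriodRing.Negative.ModelsAnatomy
import Summits.KontsevichZagierPeriods.KontsevichZagierPeriods.Theorems.ReducedPeriodRing.Negative.DimZero
import Summits.KontsevichZagierPeriods.KontsevichZagierPeriods.Theorems.ReducedPeriodRing.Negative.PositiveCone
import Literature.NumberTheory.Transcendental.KZRegCalculus
import Literature.NumberTheory.Transcendental.KZCalculusProofs

/-!
# drefute checks for line `effective-end-monoid` of crux `ReducedPeriodRing` (stmt-KontsevichZagierPeriods-3929)
# — in the LEAD's vocabulary (DEFS block verbatim from `Lines/effective-end-monoid.lean`)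

Refuter (deep-refute) certificates on the reshaped stub set (registry 2026-08-16T02:18:59Z).
All `sorry`-free; axioms {propext, Classical.choice, Quot.sound}.

* COSTUME — `stub_cubicalSqrtClosed` **is the crux modulo the other stubs**:
  `sqrtClosed_of_reduced` (S2 ∧ S3 ∧ crux ⇒ S4) and `reduced_of_stubs` (S1 ∧ S2 ∧ S3 ∧ S4 ⇒ crux,
  the line's composition) give `sqrtClosed_iff_reduced`; without S1: `sqrtClosed_iff_reduced_on_cubes`
  (mod S2 ∧ S3, S4 ⇔ crux restricted to tame cube classes).
* DEGENERATE INSTANCE — `coherence_dim0`, `sqrtClosed_dim0`: dimension `0` (constants) carries no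
  counterexample to S3 / S4.
* LOAD-BEARING HYPOTHESIS of S3 — `coherence_false_without_analytic`: dropping "integrand analytic
  near the cube" makes S3 FALSE (witness `[ [0,1], 𝟙_{x=1/2} ]`: a KZ relation (a.e.-zero integrand)
  that is not in `cubeRelations`, by the support functional `supportAt`: `cubeRelations` only
  involves tame cube generators). So S3's content is exactly the conversion of arbitrary KZ chains
  (non-analytic integrands, non-cube domains) into cubical ones; nothing is formal.
* `cubeRelations_le_cubicalSpan` — cubical relations are combinations of tame cube classes.
-/

noncomputable section

namespace Summit.KontsevichZagierPeriods.FurushoPentagon.ReducedPeriodRing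
-- BEGIN DEFS (verbatim body of Theorems/FurushoPentagonReducedPeriodRingDefs.lean)


open Set
open Literature.NumberTheory.Transcendental Literature.NumberTheory.Transcendental.KZ

/-- The closed unit cube `[0,1]ⁿ = {x : ℝⁿ | ∀ i, 0 ≤ x i ≤ 1}`.
[Kontsevich–Zagier 2001, §1.1; Ayoub 2014, Def. 6] -/
def unitCube (n : ℕ) : Set (Fin n → ℝ) := {x | ∀ i, 0 ≤ x i ∧ x i ≤ 1}

/-- Membership in the unit cube. [folklore] -/
@[simp] theorem mem_unitCube {n : ℕ} (x : Fin n → ℝ) : x ∈ unitCube n ↔ ∀ i, 0 ≤ x i ∧ x i ≤ 1 :=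
  Iff.rfl

/-- The *tame cube classes*: generators `[r]` of `KZ.FormalRep` whose domain is the closed unit
cube and whose integrand is real analytic on a neighbourhood of each point of the cube.
[Ayoub 2014, Def. 6 (generators of `P^eff_KZ`); Huber–Müller-Stach 2017, §12.1] -/
def cubicalGens : Set FormalRep :=
  {d | ∃ (n : ℕ) (r : IntegralRep n),
    r.domain = unitCube n ∧ AnalyticOnNhd ℝ r.integrand (unitCube n) ∧ d = of r}

/-- The subgroup of `KZ.FormalRep` generated by the tame cube classes (`ℤ[tame cube classes]`).
[Ayoub 2014, Def. 6] -/
def cubicalSpan : AddSubgroup FormalRep := AddSubgroup.closure cubicalGens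

/-- **Cubical move (1b)**: integrand additivity `f = f₁ + f₂` between tame cube classes of the same
dimension. [Kontsevich–Zagier 2001, §1.2 rule (1)] -/
def cubeIntegrandAddRel : Set FormalRep :=
  {c | ∃ (n : ℕ) (r r₁ r₂ : IntegralRep n),
    r.domain = unitCube n ∧ AnalyticOnNhd ℝ r.integrand (unitCube n) ∧
    r₁.domain = unitCube n ∧ AnalyticOnNhd ℝ r₁.integrand (unitCube n) ∧
    r₂.domain = unitCube n ∧ AnalyticOnNhd ℝ r₂.integrand (unitCube n) ∧
    EqOn r.integrand (r₁.integrand + r₂.integrand) (unitCube n) ∧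
    c = of r - of r₁ - of r₂}

/-- **Cubical move (3)**: Newton–Leibniz along the last coordinate of the cube `[0,1]ⁿ⁺¹ → [0,1]ⁿ`,
`∫_{[0,1]ⁿ⁺¹} ∂ₜF = ∫_{[0,1]ⁿ} (F(x,1) − F(x,0))`, for a primitive `F` which is analytic on a
neighbourhood of the cube, `ℚ`-semialgebraic on it, and has `∂ₜ F = f` on every closed fibre.
[Kontsevich–Zagier 2001, §1.2 rule (3); Ayoub 2014, Def. 6 (Stokes generators)] -/
def cubeNewtonLeibnizRel : Set FormalRep :=
  {c | ∃ (n : ℕ) (r : IntegralRep (n + 1)) (r' : IntegralRep n) (F : (Fin (n + 1) → ℝ) → ℝ),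
    r.domain = unitCube (n + 1) ∧ AnalyticOnNhd ℝ r.integrand (unitCube (n + 1)) ∧
    r'.domain = unitCube n ∧ AnalyticOnNhd ℝ r'.integrand (unitCube n) ∧
    AnalyticOnNhd ℝ F (unitCube (n + 1)) ∧ IsSemialgebraicFunOn ℚ (unitCube (n + 1)) F ∧
    (∀ x ∈ unitCube n, ∀ t ∈ Icc (0 : ℝ) 1,
      HasDerivAt (fun s : ℝ => F (Fin.snoc x s)) (r.integrand (Fin.snoc x t)) t) ∧
    (∀ x ∈ unitCube n, r'.integrand x = F (Fin.snoc x 1) - F (Fin.snoc x 0)) ∧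
    c = of r - of r'}

/-- **Cubical move (2)**: change of variables along a `ℚ`-semialgebraic analytic diffeomorphism
`Φ` of the cube onto itself, `∫_{[0,1]ⁿ} f'(Φ x) |det Φ'(x)| = ∫_{[0,1]ⁿ} f'`.
[Kontsevich–Zagier 2001, §1.2 rule (2)] -/
def cubeChangeOfVariablesRel : Set FormalRep :=
  {c | ∃ (n : ℕ) (r r' : IntegralRep n) (Φ : (Fin n → ℝ) → (Fin n → ℝ))
      (Φ' : (Fin n → ℝ) → ((Fin n → ℝ) →L[ℝ] (Fin n → ℝ))),
    r.domain = unitCube n ∧ AnalyticOnNhd ℝ r.integrand (unitCube n) ∧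
    r'.domain = unitCube n ∧ AnalyticOnNhd ℝ r'.integrand (unitCube n) ∧
    IsSemialgebraicMapOn ℚ (unitCube n) Φ ∧
    (∀ x ∈ unitCube n, HasFDerivWithinAt Φ (Φ' x) (unitCube n) x) ∧
    InjOn Φ (unitCube n) ∧ Φ '' unitCube n = unitCube n ∧
    (∀ i : Fin n, AnalyticOnNhd ℝ (fun x : Fin n → ℝ => Φ x i) (unitCube n)) ∧
    (∀ x ∈ unitCube n, r.integrand x = r'.integrand (Φ x) * |(Φ' x).det|) ∧
    c = of r - of r'}

/-- **Cubical move (1a)**: dyadic halving of the `i`-th coordinate,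
`∫_{[0,1]ⁿ} f = ∫_{[0,1]ⁿ} ½ f(…, xᵢ/2, …) + ∫_{[0,1]ⁿ} ½ f(…, (1+xᵢ)/2, …)` (domain additivity
along the null wall `xᵢ = ½` followed by the two affine rescalings of the halves to the cube).
[Kontsevich–Zagier 2001, §1.2 rules (1), (2)] -/
def cubeHalvingRel : Set FormalRep :=
  {c | ∃ (n : ℕ) (r r₁ r₂ : IntegralRep n) (i : Fin n),
    r.domain = unitCube n ∧ AnalyticOnNhd ℝ r.integrand (unitCube n) ∧
    r₁.domain = unitCube n ∧ AnalyticOnNhd ℝ r₁.integrand (unitCube n) ∧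
    r₂.domain = unitCube n ∧ AnalyticOnNhd ℝ r₂.integrand (unitCube n) ∧
    (∀ x ∈ unitCube n, r₁.integrand x = (1 / 2 : ℝ) * r.integrand (Function.update x i (x i / 2))) ∧
    (∀ x ∈ unitCube n,
      r₂.integrand x = (1 / 2 : ℝ) * r.integrand (Function.update x i ((1 + x i) / 2))) ∧
    c = of r - of r₁ - of r₂}

/-- The four cubical move families together. [Kontsevich–Zagier 2001, §1.2] -/
def cubeMoves : Set FormalRep :=
  cubeIntegrandAddRel ∪ cubeNewtonLeibnizRel ∪ cubeChangeOfVariablesRel ∪ cubeHalvingRel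

/-- The subgroup of `KZ.FormalRep` generated by the cubical moves: the relations of the cubical
effective sub-calculus (`A_□ = cubicalSpan ⧸ cubeRelations`). [Kontsevich–Zagier 2001, §1.2] -/
def cubeRelations : AddSubgroup FormalRep := AddSubgroup.closure cubeMoves

/-- Each cubical move family lies in `cubeMoves`. [folklore] -/
theorem cubeIntegrandAddRel_subset_cubeMoves : cubeIntegrandAddRel ⊆ cubeMoves := fun _ hc =>
  Or.inl (Or.inl (Or.inl hc))

/-- Each cubical move family lies in `cubeMoves`. [folklore] -/
theorem cubeNewtonLeibnizRel_subset_cubeMoves : cubeNewtonLeibnizRel ⊆ cubeMoves := fun _ hc =>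
  Or.inl (Or.inl (Or.inr hc))

/-- Each cubical move family lies in `cubeMoves`. [folklore] -/
theorem cubeChangeOfVariablesRel_subset_cubeMoves : cubeChangeOfVariablesRel ⊆ cubeMoves :=
  fun _ hc => Or.inl (Or.inr hc)

/-- Each cubical move family lies in `cubeMoves`. [folklore] -/
theorem cubeHalvingRel_subset_cubeMoves : cubeHalvingRel ⊆ cubeMoves := fun _ hc => Or.inr hc

-- END DEFS

open Set MeasureTheory MvPolynomial
open Literature.NumberTheory.Transcendental Literature.NumberTheory.Transcendental.KZ
open Literature.ModelTheory.ExponentialFields (IsSemialgebraic)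
open Summit.KontsevichZagierPeriods.KontsevichZagierPeriods.Theses.FurushoPentagon
open Summit.KontsevichZagierPeriods.KontsevichZagierPeriods.ReducedPeriodRingNegative

/-! ## The stubs as propositions (exact registered signatures) -/

/-- S1 = S1b ∘ S1a (cube compilation), as one proposition. -/
def CubeCompilation : Prop := ∀ (N : ℕ) (u : IntegralRep N), ∃ (n : ℕ) (r : IntegralRep n),
  r.domain = unitCube n ∧ AnalyticOnNhd ℝ r.integrand (unitCube n) ∧ of u - of r ∈ relations

/-- S2 (a ∧ b ∧ c) as one proposition. -/
def CubicalSound : Prop := cubeRelations ≤ relations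

/-- S3 `stub_cubicalCoherence`. -/
def CubicalCoherence : Prop := ∀ (n : ℕ) (r : IntegralRep n), r.domain = unitCube n →
  AnalyticOnNhd ℝ r.integrand (unitCube n) → of r ∈ relations → of r ∈ cubeRelations

/-- S4 `stub_cubicalSqrtClosed`. -/
def CubicalSqrtClosed : Prop := ∀ (n : ℕ) (r : IntegralRep n), r.domain = unitCube n →
  AnalyticOnNhd ℝ r.integrand (unitCube n) → of (r.prod r) ∈ cubeRelations → of r ∈ cubeRelations

/-! ## Glue: `r.prod r` is again a tame cube class -/

variable {n m : ℕ}

theorem prodDomain_eq_unitCube' (r : IntegralRep n) (s : IntegralRep m) (hr : r.domain = unitCube n)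
    (hs : s.domain = unitCube m) : (r.prod s).domain = unitCube (n + m) := by
  ext z
  simp only [IntegralRep.prod_domain, IntegralRep.mem_prodDomain, hr, hs, mem_unitCube]
  exact (Fin.forall_fin_add (fun i => 0 ≤ z i ∧ z i ≤ 1)).symm

theorem analyticOnNhd_prod_integrand' (r : IntegralRep n) (s : IntegralRep m)
    (har : AnalyticOnNhd ℝ r.integrand (unitCube n)) (has : AnalyticOnNhd ℝ s.integrand (unitCube m)) :
    AnalyticOnNhd ℝ (r.prod s).integrand (unitCube (n + m)) := by
  rw [IntegralRep.prod_integrand_eq]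
  have hp₁ : AnalyticOnNhd ℝ (fun z : Fin (n + m) → ℝ => fun i => z (Fin.castAdd m i)) univ :=
    AnalyticOnNhd.pi fun i =>
      (ContinuousLinearMap.proj (R := ℝ) (φ := fun _ : Fin (n + m) => ℝ) (Fin.castAdd m i)).analyticOnNhd _
  have hp₂ : AnalyticOnNhd ℝ (fun z : Fin (n + m) → ℝ => fun j => z (Fin.natAdd n j)) univ :=
    AnalyticOnNhd.pi fun j =>
      (ContinuousLinearMap.proj (R := ℝ) (φ := fun _ : Fin (n + m) => ℝ) (Fin.natAdd n j)).analyticOnNhd _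
  have h1 : AnalyticOnNhd ℝ (fun z : Fin (n + m) → ℝ => r.integrand (fun i => z (Fin.castAdd m i)))
      (unitCube (n + m)) :=
    har.comp (hp₁.mono (subset_univ _)) fun z hz i => hz (Fin.castAdd m i)
  have h2 : AnalyticOnNhd ℝ (fun z : Fin (n + m) → ℝ => s.integrand (fun j => z (Fin.natAdd n j)))
      (unitCube (n + m)) :=
    has.comp (hp₂.mono (subset_univ _)) fun z hz j => hz (Fin.natAdd n j)
  exact h1.mul h2

/-! ## COSTUME: S4 is the crux modulo the other stubs -/

/-- Given S2 and S3, the crux implies S4. -/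
theorem sqrtClosed_of_reduced (h2 : CubicalSound) (h3 : CubicalCoherence)
    (hc : ReducedPeriodRing) : CubicalSqrtClosed := by
  intro n r hd ha hsq
  have h1' : KZ.of r * KZ.of r ∈ relations := by rw [of_mul_of]; exact h2 hsq
  exact h3 n r hd ha (hc _ h1')

/-- The line's composition: S1 ∧ S2 ∧ S3 ∧ S4 ⇒ crux. -/
theorem reduced_of_stubs (h1 : CubeCompilation) (h2 : CubicalSound) (h3 : CubicalCoherence)
    (h4 : CubicalSqrtClosed) : ReducedPeriodRing := by
  by_contra hnr
  obtain ⟨N, u, hsq, hne⟩ := not_reducedPeriodRing_iff_single.mp hnr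
  obtain ⟨n, r, hd, ha, hur⟩ := h1 N u
  have hru : KZ.of r - KZ.of u ∈ relations := by simpa using relations.neg_mem hur
  have hmul := mul_sub_mul_mem_relations hru hru
  have huu : KZ.of u * KZ.of u ∈ relations := by rw [of_mul_of]; exact hsq
  have hrr : KZ.of (r.prod r) ∈ relations := by
    have := relations.add_mem hmul huu
    simpa [of_mul_of] using this
  have h3' := h3 (n + n) (r.prod r) (prodDomain_eq_unitCube' r r hd hd)
    (analyticOnNhd_prod_integrand' r r ha ha) hrr
  have h4' : KZ.of r ∈ relations := h2 (h4 n r hd ha h3')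
  exact hne (by simpa using relations.sub_mem h4' hru)

/-- **S4 ⇔ crux modulo S1–S3**: the hardest stub is exactly crux-hard. -/
theorem sqrtClosed_iff_reduced (h1 : CubeCompilation) (h2 : CubicalSound) (h3 : CubicalCoherence) :
    CubicalSqrtClosed ↔ ReducedPeriodRing :=
  ⟨reduced_of_stubs h1 h2 h3, sqrtClosed_of_reduced h2 h3⟩

/-- Without S1: modulo S2 ∧ S3, S4 is the crux restricted to tame cube classes. -/
theorem sqrtClosed_iff_reduced_on_cubes (h2 : CubicalSound) (h3 : CubicalCoherence) :
    CubicalSqrtClosed ↔ ∀ (n : ℕ) (r : IntegralRep n), r.domain = unitCube n →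
      AnalyticOnNhd ℝ r.integrand (unitCube n) → KZ.of (r.prod r) ∈ relations → KZ.of r ∈ relations := by
  constructor
  · intro h4 n r hd ha hrr
    exact h2 (h4 n r hd ha (h3 (n + n) (r.prod r) (prodDomain_eq_unitCube' r r hd hd)
      (analyticOnNhd_prod_integrand' r r ha ha) hrr))
  · intro h n r hd ha hsq
    exact h3 n r hd ha (h n r hd ha (h2 hsq))

/-- S3 is only ever CONSUMED at Fubini squares: this weaker form already suffices for the composition. -/
def CubicalCoherenceOnSquares : Prop := ∀ (n : ℕ) (r : IntegralRep n), r.domain = unitCube n →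
  AnalyticOnNhd ℝ r.integrand (unitCube n) → of (r.prod r) ∈ relations → of (r.prod r) ∈ cubeRelations

theorem reduced_of_stubs' (h1 : CubeCompilation) (h2 : CubicalSound) (h3 : CubicalCoherenceOnSquares)
    (h4 : CubicalSqrtClosed) : ReducedPeriodRing := by
  by_contra hnr
  obtain ⟨N, u, hsq, hne⟩ := not_reducedPeriodRing_iff_single.mp hnr
  obtain ⟨n, r, hd, ha, hur⟩ := h1 N u
  have hru : KZ.of r - KZ.of u ∈ relations := by simpa using relations.neg_mem hur
  have hmul := mul_sub_mul_mem_relations hru hru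
  have huu : KZ.of u * KZ.of u ∈ relations := by rw [of_mul_of]; exact hsq
  have hrr : KZ.of (r.prod r) ∈ relations := by
    have := relations.add_mem hmul huu
    simpa [of_mul_of] using this
  have h4' : KZ.of r ∈ relations := h2 (h4 n r hd ha (h3 n r hd ha hrr))
  exact hne (by simpa using relations.sub_mem h4' hru)

/-! ## Degenerate dimension `n = 0` carries no counterexample to S3 / S4 -/

theorem unitCube_zero : unitCube 0 = univ := by
  ext x; simp

/-- Family (1b) kills a tame cube class whose integrand vanishes on the cube. -/
theorem of_mem_cubeRelations_of_eqOn_zero {k : ℕ} (r : IntegralRep k) (hd : r.domain = unitCube k)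
    (ha : AnalyticOnNhd ℝ r.integrand (unitCube k)) (h0 : EqOn r.integrand 0 (unitCube k)) :
    KZ.of r ∈ cubeRelations := by
  have hmem : KZ.of r - KZ.of r - KZ.of r ∈ cubeMoves := by
    refine cubeIntegrandAddRel_subset_cubeMoves ⟨k, r, r, r, hd, ha, hd, ha, hd, ha, ?_, rfl⟩
    intro x hx
    have := h0 hx
    simp only [Pi.zero_apply] at this
    simp [this]
  have h : KZ.of r - KZ.of r - KZ.of r ∈ cubeRelations := AddSubgroup.subset_closure hmem
  have heq : KZ.of r - KZ.of r - KZ.of r = -KZ.of r := by abel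
  rw [heq] at h
  exact (AddSubgroup.neg_mem_iff _).mp h

theorem integrand_default_eq_zero_of_mem_relations (r : IntegralRep 0) (hd : r.domain = unitCube 0)
    (hr : KZ.of r ∈ relations) : r.integrand default = 0 := by
  have hv : r.value = 0 := by simpa using relations_le_ker_eval_holds hr
  rwa [value_eq_integrand_default r (by rw [hd, unitCube_zero])] at hv

/-- **S3 holds in dimension 0.** -/
theorem coherence_dim0 (r : IntegralRep 0) (hd : r.domain = unitCube 0)
    (ha : AnalyticOnNhd ℝ r.integrand (unitCube 0)) (hr : KZ.of r ∈ relations) :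
    KZ.of r ∈ cubeRelations := by
  refine of_mem_cubeRelations_of_eqOn_zero r hd ha fun x _ => ?_
  rw [Subsingleton.elim x default]
  simpa using integrand_default_eq_zero_of_mem_relations r hd hr

/-- **S4 holds in dimension 0** (given S2). -/
theorem sqrtClosed_dim0 (h2 : CubicalSound) (r : IntegralRep 0) (hd : r.domain = unitCube 0)
    (ha : AnalyticOnNhd ℝ r.integrand (unitCube 0)) (hsq : KZ.of (r.prod r) ∈ cubeRelations) :
    KZ.of r ∈ cubeRelations := by
  have h0 : (r.prod r).integrand default = 0 :=
    integrand_default_eq_zero_of_mem_relations (r.prod r) (prodDomain_eq_unitCube' r r hd hd) (h2 hsq)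
  have h0' : r.integrand default = 0 := by
    rw [IntegralRep.prod_integrand_eq] at h0
    simp only [IntegralRep.prodFun_apply] at h0
    have e1 : (fun i : Fin 0 => (default : Fin (0 + 0) → ℝ) (Fin.castAdd 0 i)) = default :=
      Subsingleton.elim _ _
    have e2 : (fun j : Fin 0 => (default : Fin (0 + 0) → ℝ) (Fin.natAdd 0 j)) = default :=
      Subsingleton.elim _ _
    rw [e1, e2] at h0
    exact mul_self_eq_zero.mp h0
  refine of_mem_cubeRelations_of_eqOn_zero r hd ha fun x _ => ?_
  rw [Subsingleton.elim x default]
  simpa using h0'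

/-! ## `cubeRelations` only involves tame cube generators -/

/-- Every cubical move is a combination of tame cube classes. -/
theorem cubeMoves_subset_cubicalSpan : cubeMoves ⊆ (cubicalSpan : Set FormalRep) := by
  have hg : ∀ {k : ℕ} (s : IntegralRep k), s.domain = unitCube k →
      AnalyticOnNhd ℝ s.integrand (unitCube k) → KZ.of s ∈ cubicalSpan :=
    fun s hd ha => AddSubgroup.subset_closure ⟨_, s, hd, ha, rfl⟩
  rintro c (((hc | hc) | hc) | hc)
  · obtain ⟨k, r, r₁, r₂, hd, ha, hd₁, ha₁, hd₂, ha₂, -, rfl⟩ := hc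
    exact cubicalSpan.sub_mem (cubicalSpan.sub_mem (hg r hd ha) (hg r₁ hd₁ ha₁)) (hg r₂ hd₂ ha₂)
  · obtain ⟨k, r, r', F, hd, ha, hd', ha', -, -, -, -, rfl⟩ := hc
    exact cubicalSpan.sub_mem (hg r hd ha) (hg r' hd' ha')
  · obtain ⟨k, r, r', Φ, Φ', hd, ha, hd', ha', -, -, -, -, -, -, rfl⟩ := hc
    exact cubicalSpan.sub_mem (hg r hd ha) (hg r' hd' ha')
  · obtain ⟨k, r, r₁, r₂, i, hd, ha, hd₁, ha₁, hd₂, ha₂, -, -, rfl⟩ := hc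
    exact cubicalSpan.sub_mem (cubicalSpan.sub_mem (hg r hd ha) (hg r₁ hd₁ ha₁)) (hg r₂ hd₂ ha₂)

/-- Cubical relations are combinations of tame cube classes. -/
theorem cubeRelations_le_cubicalSpan : cubeRelations ≤ cubicalSpan :=
  (AddSubgroup.closure_le _).mpr cubeMoves_subset_cubicalSpan

/-- The **support functional** at a generator `x = ⟨k, s⟩`: coefficient extraction. [folklore] -/
def supportAt (x : Σ k, IntegralRep k) : FormalRep →+ ℤ :=
  FreeAbelianGroup.lift fun y => by classical exact if y = x then 1 else 0

theorem supportAt_of_self {k : ℕ} (s : IntegralRep k) : supportAt ⟨k, s⟩ (KZ.of s) = 1 := by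
  unfold supportAt KZ.of
  rw [FreeAbelianGroup.lift_apply_of]
  simp

theorem supportAt_of_ne {k l : ℕ} (s : IntegralRep k) (r : IntegralRep l)
    (h : (⟨l, r⟩ : Σ k, IntegralRep k) ≠ ⟨k, s⟩) : supportAt ⟨k, s⟩ (KZ.of r) = 0 := by
  unfold supportAt KZ.of
  rw [FreeAbelianGroup.lift_apply_of]
  simp only [ite_eq_right_iff]
  exact fun h' => absurd h' h

/-- A generator whose integrand is NOT analytic near the cube has coefficient `0` in every tame
cube class, hence in every element of `cubicalSpan`. -/
theorem cubicalSpan_le_ker_supportAt {k : ℕ} (s : IntegralRep k)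
    (hs : ¬ AnalyticOnNhd ℝ s.integrand (unitCube k)) : cubicalSpan ≤ (supportAt ⟨k, s⟩).ker := by
  refine (AddSubgroup.closure_le _).mpr ?_
  rintro d ⟨l, r, hd, ha, rfl⟩
  rw [SetLike.mem_coe, AddMonoidHom.mem_ker]
  by_cases h : (⟨l, r⟩ : Σ k, IntegralRep k) = ⟨k, s⟩
  · exfalso
    obtain ⟨rfl, h2⟩ := Sigma.mk.inj_iff.mp h
    have : r = s := eq_of_heq h2
    subst this
    exact hs ha
  · exact supportAt_of_ne s r h

/-! ## S3 without analyticity is false -/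

/-- The wall `{x 0 = 1/2}` in `ℝ¹`. -/
def wall : Set (Fin 1 → ℝ) := {x | x 0 = 1 / 2}

theorem isSemialgebraic_wall : IsSemialgebraic ℚ wall := by
  have : wall = {x : Fin 1 → ℝ | aeval x (X 0 - C (1 / 2 : ℚ) : MvPolynomial (Fin 1) ℚ) = 0} := by
    ext x
    simp [wall, sub_eq_zero]
  rw [this]
  exact Literature.ModelTheory.ExponentialFields.isSemialgebraic_setOf_eval_eq_zero _

theorem isSemialgebraic_unitCube (n : ℕ) : IsSemialgebraic ℚ (unitCube n) := by
  have : unitCube n = ⋂ i ∈ (Finset.univ : Finset (Fin n)),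
      ({x : Fin n → ℝ | 0 ≤ aeval x (X i : MvPolynomial (Fin n) ℚ)} ∩
        {x | aeval x (X i : MvPolynomial (Fin n) ℚ) ≤ aeval x (1 : MvPolynomial (Fin n) ℚ)}) := by
    ext x
    simp [forall_and]
  rw [this]
  exact IsSemialgebraic.biInter _ _ fun i _ =>
    (Literature.ModelTheory.ExponentialFields.isSemialgebraic_setOf_eval_nonneg _).inter
      (Literature.ModelTheory.ExponentialFields.isSemialgebraic_setOf_eval_le _ _)

theorem unitCube_eq_Icc (n : ℕ) : unitCube n = Icc (0 : Fin n → ℝ) 1 := by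
  ext x
  simp [Pi.le_def, forall_and]

theorem isClosed_wall : IsClosed wall := isClosed_eq (continuous_apply 0) continuous_const

/-- The witness: `[ [0,1], 𝟙_{x = 1/2} ]`. -/
def wallRep : IntegralRep 1 where
  domain := unitCube 1
  integrand := wall.indicator fun _ => 1
  isSemialgebraic_domain := isSemialgebraic_unitCube 1
  isSemialgebraicFunOn_integrand :=
    IsSemialgebraicFunOn.indicator (isSemialgebraic_unitCube 1) isSemialgebraic_wall
      ((isSemialgebraicFunOn_aeval ((isSemialgebraic_unitCube 1).inter isSemialgebraic_wall) 1).congr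
        fun x _ => by simp)
  integrableOn := by
    have hfin : volume (unitCube 1) < ⊤ := by
      rw [unitCube_eq_Icc]; exact isCompact_Icc.measure_lt_top
    have : IntegrableOn (fun _ : Fin 1 → ℝ => (1 : ℝ)) (unitCube 1) := integrableOn_const hfin.ne
    exact this.indicator isClosed_wall.measurableSet

theorem wallRep_mem_relations : KZ.of wallRep ∈ relations := by
  refine of_mem_relations_of_volume_ne_zero wallRep (measure_mono_null (t := wall) ?_ ?_)
  · rintro x ⟨-, hx⟩
    by_contra h
    exact hx (by simp [wallRep, indicator_of_notMem h])
  · rw [volume_pi]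
    exact Measure.pi_hyperplane _ 0 _

theorem not_analyticOnNhd_wallRep : ¬ AnalyticOnNhd ℝ wallRep.integrand (unitCube 1) := by
  intro h
  set p : Fin 1 → ℝ := fun _ => 1 / 2 with hp
  have hpU : p ∈ unitCube 1 := fun _ => by norm_num [hp]
  have hcont : ContinuousAt wallRep.integrand p := (h p hpU).continuousAt
  rw [Metric.continuousAt_iff] at hcont
  obtain ⟨δ, hδ, hball⟩ := hcont (1 / 2) (by norm_num)
  set q : Fin 1 → ℝ := fun _ => 1 / 2 + δ / 2 with hq
  have hdist : dist q p < δ := by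
    rw [hq, hp, dist_pi_const, Real.dist_eq]
    rw [show (1 : ℝ) / 2 + δ / 2 - 1 / 2 = δ / 2 by ring, abs_of_pos (by linarith)]
    linarith
  have h1 := hball hdist
  have hfp : wallRep.integrand p = 1 := by
    simp [wallRep, wall, hp]
  have hfq : wallRep.integrand q = 0 := by
    have : q ∉ wall := by
      simp only [wall, mem_setOf_eq, hq]
      linarith
    simp [wallRep, indicator_of_notMem this]
  rw [hfp, hfq, Real.dist_eq] at h1
  norm_num at h1

/-- **S3 without the analyticity hypothesis is FALSE.** -/
theorem coherence_false_without_analytic :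
    ¬ ∀ (n : ℕ) (r : IntegralRep n), r.domain = unitCube n → KZ.of r ∈ relations → KZ.of r ∈ cubeRelations := by
  intro h
  have hmem : KZ.of wallRep ∈ cubeRelations := h 1 wallRep rfl wallRep_mem_relations
  have hker := cubicalSpan_le_ker_supportAt wallRep not_analyticOnNhd_wallRep
    (cubeRelations_le_cubicalSpan hmem)
  rw [AddMonoidHom.mem_ker, supportAt_of_self] at hker
  exact one_ne_zero hker

end Summit.KontsevichZagierPeriods.FurushoPentagon.ReducedPeriodRing
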